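import Literature.NumberTheory.GaloisRepresentations.ConjugationDescent
import Literature.NumberTheory.EllipticCurves.KummerSelmerStructure
import Literature.NumberTheory.EllipticCurves.LocalKummerMap
import Literature.NumberTheory.EllipticCurves.ShaRestriction
import Literature.NumberTheory.EllipticCurves.ZpExtension
import Literature.NumberTheory.GaloisRepresentations.LocalGlobalCohomology
import HarnessLib

/-!
# Three small inputs of the local-package assembly: an index count in a group of order `p²`, the
# localisation of a class computed through a conjugate embedding, and `#E(L_w)[p] ≥ p` from a
# rational point of order `p` (cell `b2b-bsdres`, unit `b2b-bsdres-eisenstein-p1`, gen 20;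
# X1R0-GAPMAP §28.4, §29)

HONEST FRAMING (run/shared/lean/b2b/bsd-rank1-residual/, verbatim in every file): the goal of the
cell is to DELETE the COMBINATION-SHAPED residual classes of the Birch–Swinnerton-Dyer formula for
ALL analytic-rank `≤ 1` elliptic curves over `ℚ` — "full BSD formula for every rank `≤ 1` curve in
class `C`" assembled STRICTLY from published theorems — so that the rank-`≤ 1` remainder becomes
exactly the CONSTRUCTION-SHAPED classes, which are TYPED (missing-input `Prop`s), NOT attempted.
This is not "finishing BSD". Sub-cell `b2b-bsdres-eisenstein-p1`: research route; NO CLAIM BEYOND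
STATED CLASSES; nothing here changes a label; nothing is booked. THEOREMS ONLY — no definition, no
named fact.

## What and why

For the assembly of (M1-local) (`X1/LocalStrictPackage` fed into `X1/GeneratorCountLayerAtPStrict`):

* `natCard_range_eq_of_card_eq_sq` — a homomorphism out of a group of order `p²` with a non-zero
  element in its kernel and a non-zero value has image of order exactly `p` (the group `A₀` of
  reductions of `E[p]`, `#A₀ = p`);
* `exists_cocycle_conj_eq_res` — **the localisation at `E` of the class of a cocycle `φ` is
  represented by `g ↦ τ • φ(res_{ι'} g)`** when `ι' = ι_E ∘ τ` (inner automorphisms act trivially on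
  `H¹`, tree `map_eq_map_of_inner_one`; this is the cocycle the strictness clause of the local
  package is applied to);
* `le_natCard_ker_nsmul` — a rational point of order `p` gives `p ≤ #E(L_w)[p]` (hypothesis `ht` of
  the local package).

References: [SerreLocalFields1979] VII §5 Prop. 3; [SerreGaloisCohomology1997] I.§2.4, II.§1.1;
[SilvermanAEC2009] VII.3.1; [GreenbergLNM1716] §3 Lemma 3.4.
-/

noncomputable section

open scoped Classical NNReal

open Function Field NumberField IsDedekindDomain WeierstrassCurve
  Literature.NumberTheory.EllipticCurves Literature.NumberTheory.GaloisRepresentations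
  IsDedekindDomain.HeightOneSpectrum

set_option autoImplicit false

namespace Summit.BirchSwinnertonDyer.Rank1Residual.X1.LocalPackageParts

open _root_.TopRep _root_.ContinuousCohomology CategoryTheory

/-! ## §1. The image of a homomorphism out of a group of order `p²` -/

/-- **A homomorphism out of a group of order `p²` with non-trivial, non-total kernel has image of
order `p`** (Lagrange: `#ker ∈ {1, p, p²}`). [folklore] -/
theorem natCard_range_eq_of_card_eq_sq {A B : Type*} [AddCommGroup A] [AddCommGroup B] [Finite A]
    (f : A →+ B) {p : ℕ} (hp : p.Prime) (hA : Nat.card A = p ^ 2)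
    (h1 : ∃ a, a ≠ 0 ∧ f a = 0) (h2 : ∃ a, f a ≠ 0) : Nat.card f.range = p := by
  have hmul : Nat.card A = Nat.card f.ker * Nat.card f.range := by
    rw [AddSubgroup.card_eq_card_quotient_mul_card_addSubgroup f.ker, mul_comm,
      Nat.card_congr (QuotientAddGroup.quotientKerEquivRange f).toEquiv]
  have hdvd : Nat.card f.ker ∣ p ^ 2 := hA ▸ Dvd.intro _ hmul.symm
  obtain ⟨i, hi, hker⟩ := (Nat.dvd_prime_pow hp).mp hdvd
  have hi0 : i ≠ 0 := by
    rintro rfl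
    rw [pow_zero] at hker
    obtain ⟨a, ha0, hfa⟩ := h1
    have hsub : Subsingleton f.ker := (Nat.card_eq_one_iff_unique.mp hker).1
    exact ha0 (congrArg Subtype.val (hsub.elim (⟨a, hfa⟩ : f.ker) 0))
  have hi2 : i ≠ 2 := by
    rintro rfl
    obtain ⟨a, hfa⟩ := h2
    have htop : f.ker = ⊤ := AddSubgroup.eq_top_of_card_eq _ (by rw [hker, hA])
    exact hfa ((AddMonoidHom.mem_ker).mp (htop ▸ AddSubgroup.mem_top a))
  have hi1 : i = 1 := by omega
  subst hi1
  rw [pow_one] at hker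
  have h3 : p * Nat.card f.range = p * p := by rw [← hker, ← hmul, hA, sq, hker]
  exact Nat.eq_of_mul_eq_mul_left hp.pos h3

/-! ## §2. Localisation through a conjugate embedding -/

variable {K : Type} [Field K] [NumberField K] (V : WeierstrassCurve K) (n : ℤ)
  (E : Type) [Field E] [Algebra K E]
  (ι' : AlgebraicClosure K →ₐ[K] AlgebraicClosure E) (τ : absoluteGaloisGroup K)
  (hτ : ι' = (closureEmb (K := K) E).comp
    ((show AlgebraicClosure K ≃ₐ[K] AlgebraicClosure K from τ) :
      AlgebraicClosure K →ₐ[K] AlgebraicClosure K))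

omit [NumberField K] in
include hτ in
/-- **The localisation at `E` of `[φ]` is the class of `g ↦ τ • φ(res_{ι'} g)`** for any
`K`-embedding `ι' = ι_E ∘ τ : \bar K → \bar E` (`τ ∈ Γ_K`): `res_{ι'} = τ⁻¹ (res_E ·) τ`
(`resGalOfEmb_comp`) and inner automorphisms act trivially on `H¹` (tree
`map_eq_map_of_inner_one`, Serre *Corps locaux* VII §5 Prop. 3), for the compatible pairs
`(res_{ι'}, τ •)` and `(res_E, id)`. [cite: SerreLocalFields1979, VII §5 Prop. 3]
[cite: SerreGaloisCohomology1997, I.§2.4, II.§1.1] -/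
theorem exists_cocycle_conj_eq_res
    (φ : contOneCocycles (discreteTopRep (absoluteGaloisGroup K) (geomTorsion V n))) :
    ∃ ψ : contOneCocycles (DiscreteGaloisModule.toTopRep
        (GaloisRep.restrictField E (V.torsionGaloisModule n))),
      oneCocycleClass _ ψ =
        galoisCohomology.res (V.torsionGaloisModule n) E 1
          (oneCocycleClass (discreteTopRep (absoluteGaloisGroup K) (geomTorsion V n)) φ) ∧
      ∀ g : absoluteGaloisGroup E, ψ.1 g = τ • φ.1 (resGalOfEmb ι' g) := by
  have hθ : ∀ g : absoluteGaloisGroup E, resGalOfEmb ι' g = τ⁻¹ * absGaloisRestrict K E g * τ := by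
    intro g
    have h1 := congrArg (fun f ↦ f g) (resGalOfEmb_comp (closureEmb (K := K) E)
      (show AlgebraicClosure K ≃ₐ[K] AlgebraicClosure K from τ))
    rw [← hτ] at h1
    rw [h1, ← resGal_eq_absGaloisRestrict]
    rfl
  let f₂ : TopRep.res ((absGaloisRestrict K E : absoluteGaloisGroup E →ₜ* absoluteGaloisGroup K) :
      absoluteGaloisGroup E →* absoluteGaloisGroup K)
      (discreteTopRep (absoluteGaloisGroup K) (geomTorsion V n)) ⟶
      DiscreteGaloisModule.toTopRep (GaloisRep.restrictField E (V.torsionGaloisModule n)) :=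
    TopRep.ofHom ⟨ContinuousLinearMap.id ℤ (geomTorsion V n), fun _ => rfl⟩
  let f₁ : TopRep.res ((resGalOfEmb ι' : absoluteGaloisGroup E →ₜ* absoluteGaloisGroup K) :
      absoluteGaloisGroup E →* absoluteGaloisGroup K)
      (discreteTopRep (absoluteGaloisGroup K) (geomTorsion V n)) ⟶
      DiscreteGaloisModule.toTopRep (GaloisRep.restrictField E (V.torsionGaloisModule n)) :=
    TopRep.ofHom ⟨(discreteTopRep (absoluteGaloisGroup K) (geomTorsion V n)).ρ τ, fun g => by
      apply ContinuousLinearMap.ext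
      intro v
      change (discreteTopRep (absoluteGaloisGroup K) (geomTorsion V n)).ρ τ
          ((discreteTopRep (absoluteGaloisGroup K) (geomTorsion V n)).ρ (resGalOfEmb ι' g) v) =
        (discreteTopRep (absoluteGaloisGroup K) (geomTorsion V n)).ρ (absGaloisRestrict K E g)
          ((discreteTopRep (absoluteGaloisGroup K) (geomTorsion V n)).ρ τ v)
      rw [hθ, ← ρ_mul_apply, ← ρ_mul_apply, ← mul_assoc, ← mul_assoc, mul_inv_cancel, one_mul]⟩
  refine ⟨contOneCocycles.pullback (resGalOfEmb ι') f₁ φ, ?_, fun g ↦ ?_⟩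
  · rw [← map_oneCocycleClass, V.res_torsionGaloisModule_oneCocycleClass n E, ← map_oneCocycleClass]
    exact map_eq_map_of_inner_one τ (absGaloisRestrict K E) (resGalOfEmb ι') hθ
      f₁ f₂ (fun _ ↦ rfl) _
  · rw [contOneCocycles.pullback_apply]
    rfl

/-! ## §3. `#E(L_w)[p] ≥ p` from a rational point of order `p` -/

variable (W : WeierstrassCurve ℚ) [W.IsElliptic] {p : ℕ} [hp : Fact p.Prime]
  (L : Type) [Field L] [NumberField L] (wp : HeightOneSpectrum (𝓞 L))

/-- **A rational point of order `p` gives `p ≤ #E(L_w)[p]`** (`E(ℚ) → E(L_w)` is an injective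
homomorphism, so the multiples of the image form a subgroup of order `p` of the `p`-torsion of
`E(L_w) = ((E ⊗ L) ⊗ L_w)`-points). [cite: SilvermanAEC2009, VII.3.1] -/
theorem le_natCard_ker_nsmul {T : W.toAffine.Point} (hT : addOrderOf T = p) :
    p ≤ Nat.card (nsmulAddMonoidHom p :
      ((W.baseChange L).baseChange (wp.adicCompletion L)).toAffine.Point →+ _).ker := by
  set Lw := wp.adicCompletion L
  let ι₀ : W.toAffine.Point →+ ((W.baseChange L).baseChange Lw).toAffine.Point :=
    (pointsCongr W L Lw).toAddMonoidHom.comp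
      (Affine.Point.map (W' := W) (F := ℚ) (Algebra.ofId ℚ Lw))
  have hι₀ : Function.Injective ι₀ :=
    (pointsCongr W L Lw).injective.comp (Affine.Point.map_injective (W' := W) (F := ℚ) _)
  have hT' : addOrderOf (ι₀ T) = p := by rw [addOrderOf_injective ι₀ hι₀ T, hT]
  haveI : Finite (nsmulAddMonoidHom p :
      ((W.baseChange L).baseChange Lw).toAffine.Point →+ _).ker :=
    (W.baseChange L).finite_ker_nsmul_adicCompletion wp hp.out.ne_zero
  have hle : AddSubgroup.zmultiples (ι₀ T) ≤ (nsmulAddMonoidHom p :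
      ((W.baseChange L).baseChange Lw).toAffine.Point →+ _).ker := by
    rw [AddSubgroup.zmultiples_le]
    rw [AddMonoidHom.mem_ker, nsmulAddMonoidHom_apply, ← hT', addOrderOf_nsmul_eq_zero]
  calc p = Nat.card (AddSubgroup.zmultiples (ι₀ T)) := by rw [Nat.card_zmultiples, hT']
    _ ≤ _ := Nat.card_le_card_of_injective _ (AddSubgroup.inclusion_injective hle)

end Summit.BirchSwinnertonDyer.Rank1Residual.X1.LocalPackageParts

end
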